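/- Width seat `ym-line-cbag-p1-w2` (prover-ym-line-cbag-p1-w2-g15-0; own items stmt-QuantumFields-22254 / 22893 CLOSED) on the
planner-of-record's LINE 4, route `U1DipoleHelicity`, crux `WilsonU1DipoleLawD4` (stmt-QuantumFields-25880): REDUCTION of the registered
stub 1 `stub_villainDipoleCalibration` to an explicit statement about the flux (monopole) gas ALONE — the Gaussian content being the
theorem `villainSpinWave_dipoleCalibration`.  Helper `--supports stmt-QuantumFields-25880`; the stub itself is NOT proved (its gas half is
the hypothesis).  Nothing in this file bears on the Yang–Mills mass gap. -/
import Summits.QuantumFields.YangMills.Theorems.U1DipoleHelicityVillainSpinWaveDipoleLaw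
import HarnessLib

/-!
# Crux `WilsonU1DipoleLawD4` (stmt-QuantumFields-25880): stub 1 follows from renormalised clustering of the flux gas

With the exact identity `V_{βV,n}(z) = ½e^{−(E_p+E_q)/2βV}(e^{B/βV}A⁻ − e^{−B/βV}A⁺)` (`villainPlaqCorr_eq_spinWave_gas`) write, for an
amplitude `a`,
`V = a·SW_n + R_n(a)`, `SW_n = ½e^{−(E_p+E_q)/2βV}(e^{B/βV} − e^{−B/βV})`, `R_n(a) = ½e^{−(E_p+E_q)/2βV}(e^{B/βV}(A⁻ − a) − e^{−B/βV}(A⁺ − a))`.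
The spin-wave part satisfies the stub's functional form (`villainSpinWave_dipoleCalibration`, β' = βV e^{1/(2βV)}`).  Hence:

* **`villainDipoleCalibration_of_gas`**: IF the flux gas admits a renormalised amplitude — for every `ε > 0` there is `β₁` such that for
  `βV > β₁` there are `a ∈ (0, 1]` and `C ≥ 0`, `C·Σw ≤ ε`, with `|R_n(a)| ≤ (C/βV)·w(z)` eventually in `n`, for every `z` — THEN
  `stub_villainDipoleCalibration` holds verbatim (with `β' = βV e^{1/(2βV)}/a`).

The hypothesis is the precise remaining content of stub 1 (renormalised clustering of the `d = 4` Coulomb monopole gas of FS82's duality at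
precision `βV⁻¹(1+|z|₁)⁻⁵`); it is NOT proved here or anywhere in the tree, and it is not a literature fact.  RECORD-type material on an
abelian comparison line; the Yang–Mills mass gap is NOT proved by anything here.
-/

set_option autoImplicit false

noncomputable section

namespace Summit.QuantumFields.YangMills.Theorems.U1DipoleHelicity

open Finset Filter Topology
open scoped Real Matrix
open Literature.Probability.LatticeModels Literature.MathematicalPhysics.QuantumFieldTheory
open Literature.MathematicalPhysics.QuantumFieldTheory.VillainAngle
open Literature.Probability.LatticeModels.GaussianCoord (gram perpPart exactEnergy)

/-- **Stub 1 of crux 25880 from renormalised clustering of the flux gas.**  Hypothesis (the monopole half, NOT proved): for every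
`ε > 0` there is `β₁ ≥ 1` such that for every `βV > β₁` there are an amplitude `0 < a ≤ 1` and `C ≥ 0` with `C·Σ_z w(z) ≤ ε` such that for
every `z`, eventually in `n`, the gas remainder `R_n(a) = ½e^{−(E_p+E_q)/2βV}(e^{B/βV}(A⁻ − a) − e^{−B/βV}(A⁺ − a))` of the cube
`B_{2n+1}` (`p = (n𝟙;0,1)`, `q = (z+n𝟙;0,1)`; `E_p, E_q, B, A^∓` as in `villainPlaqCorr_eq_spinWave_gas`) is `≤ (C/βV)·w(z)` in modulus.
Conclusion: `stub_villainDipoleCalibration` verbatim.  Proof: `V = a·SW_n + R_n(a)` and the Gaussian half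
`villainSpinWave_dipoleCalibration`, with `β' = β'_{SW}/a`. [cite: FrohlichSpencerCMP1982, §2.11 (2.89)–(2.91)] -/
theorem villainDipoleCalibration_of_gas
    (hgas : ∀ ε : ℝ, 0 < ε → ∃ β₁ : ℝ, 1 ≤ β₁ ∧ ∀ βV : ℝ, β₁ < βV → ∃ a : ℝ, 0 < a ∧ a ≤ 1 ∧ ∃ C : ℝ, 0 ≤ C ∧
      C * (∑' z, weight z) ≤ ε ∧ ∀ z : Literature.Probability.LatticeModels.Site 4, ∀ᶠ n : ℕ in atTop,
        ∀ hn : Site.supNorm z + 1 ≤ n,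
        |1 / 2 * Real.exp (-(exactEnergy dMat (Pi.single (⟨(diag 4 n, 0, 1), diag_mem_plaquettesIn (one_le_of_supNorm_succ_le z hn)⟩ :
              PIdx 4 (2 * n + 1)) (1 : ℝ)) +
            exactEnergy dMat (Pi.single (⟨(z + diag 4 n, 0, 1), add_diag_mem_plaquettesIn z hn⟩ : PIdx 4 (2 * n + 1)) (1 : ℝ))) /
            (2 * βV)) *
          (Real.exp (((dMatᵀ *ᵥ (Pi.single (⟨(diag 4 n, 0, 1), diag_mem_plaquettesIn (one_le_of_supNorm_succ_le z hn)⟩ :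
                  PIdx 4 (2 * n + 1)) (1 : ℝ) : PIdx 4 (2 * n + 1) → ℝ)) ⬝ᵥ
                ((gram (dMat (d := 4) (n := 2 * n + 1)))⁻¹ *ᵥ (dMatᵀ *ᵥ
                  (Pi.single (⟨(z + diag 4 n, 0, 1), add_diag_mem_plaquettesIn z hn⟩ : PIdx 4 (2 * n + 1)) (1 : ℝ) :
                    PIdx 4 (2 * n + 1) → ℝ)))) / βV) *
              ((∑' ξ : (PIdx 4 (2 * n + 1) → ℤ) ⧸ (VillainFibre.dFree (d := 4) (n := 2 * n + 1)).range,
                  coulombWeight βV ξ * Real.cos (perpPart dMat (fluxRep ξ) ⬝ᵥ fun r =>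
                    ((Pi.single (⟨(diag 4 n, 0, 1), diag_mem_plaquettesIn (one_le_of_supNorm_succ_le z hn)⟩ : PIdx 4 (2 * n + 1))
                        (1 : ℤ) -
                      Pi.single (⟨(z + diag 4 n, 0, 1), add_diag_mem_plaquettesIn z hn⟩ : PIdx 4 (2 * n + 1)) 1 :
                        PIdx 4 (2 * n + 1) → ℤ) r : ℝ))) /
                ∑' ξ : (PIdx 4 (2 * n + 1) → ℤ) ⧸ (VillainFibre.dFree (d := 4) (n := 2 * n + 1)).range, coulombWeight βV ξ - a) -
            Real.exp (-((dMatᵀ *ᵥ (Pi.single (⟨(diag 4 n, 0, 1), diag_mem_plaquettesIn (one_le_of_supNorm_succ_le z hn)⟩ :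
                  PIdx 4 (2 * n + 1)) (1 : ℝ) : PIdx 4 (2 * n + 1) → ℝ)) ⬝ᵥ
                ((gram (dMat (d := 4) (n := 2 * n + 1)))⁻¹ *ᵥ (dMatᵀ *ᵥ
                  (Pi.single (⟨(z + diag 4 n, 0, 1), add_diag_mem_plaquettesIn z hn⟩ : PIdx 4 (2 * n + 1)) (1 : ℝ) :
                    PIdx 4 (2 * n + 1) → ℝ)))) / βV) *
              ((∑' ξ : (PIdx 4 (2 * n + 1) → ℤ) ⧸ (VillainFibre.dFree (d := 4) (n := 2 * n + 1)).range,
                  coulombWeight βV ξ * Real.cos (perpPart dMat (fluxRep ξ) ⬝ᵥ fun r =>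
                    ((Pi.single (⟨(diag 4 n, 0, 1), diag_mem_plaquettesIn (one_le_of_supNorm_succ_le z hn)⟩ : PIdx 4 (2 * n + 1))
                        (1 : ℤ) +
                      Pi.single (⟨(z + diag 4 n, 0, 1), add_diag_mem_plaquettesIn z hn⟩ : PIdx 4 (2 * n + 1)) 1 :
                        PIdx 4 (2 * n + 1) → ℤ) r : ℝ))) /
                ∑' ξ : (PIdx 4 (2 * n + 1) → ℤ) ⧸ (VillainFibre.dFree (d := 4) (n := 2 * n + 1)).range, coulombWeight βV ξ - a))|
          ≤ C / βV * weight z) :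
    ∀ ε : ℝ, 0 < ε → ∃ β₁ : ℝ, 1 ≤ β₁ ∧ ∀ βV : ℝ, β₁ < βV → ∃ β' : ℝ, 0 < β' ∧ ∃ C : ℝ, 0 ≤ C ∧
      C * (∑' z, weight z) ≤ ε ∧ ∀ z, ∀ᶠ n : ℕ in Filter.atTop,
        |villainPlaqCorr βV n z - freeK z / β'| ≤ C / βV * weight z := by
  intro ε hε
  have hε2 : 0 < ε / 2 := by linarith
  obtain ⟨βg, hβg1, Hg⟩ := hgas (ε / 2) hε2
  obtain ⟨βs, hβs1, Hs⟩ := villainSpinWave_dipoleCalibration (ε / 2) hε2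
  refine ⟨max βg βs, le_trans hβg1 (le_max_left _ _), fun βV hβ => ?_⟩
  have hβg : βg < βV := lt_of_le_of_lt (le_max_left _ _) hβ
  have hβs : βs < βV := lt_of_le_of_lt (le_max_right _ _) hβ
  have hβpos : 0 < βV := by linarith [le_trans hβg1 (le_max_left βg βs)]
  obtain ⟨a, ha0, ha1, Cg, hCg0, hCgS, HGz⟩ := Hg βV hβg
  obtain ⟨β's, hβ's, Cs, hCs0, hCsS, HSz⟩ := Hs βV hβs
  refine ⟨β's / a, by positivity, Cg + Cs, by positivity, ?_, fun z => ?_⟩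
  · rw [add_mul]; linarith
  · filter_upwards [HGz z, HSz z, eventually_ge_atTop (Site.supNorm z + 1)] with n hG hS hn
    have hG' := hG hn
    have hS' := hS hn
    rw [villainPlaqCorr_eq_spinWave_gas hβpos z hn]
    -- abbreviations for the readable algebra
    set P : ℝ := Real.exp (-(exactEnergy dMat (Pi.single (⟨(diag 4 n, 0, 1), diag_mem_plaquettesIn (one_le_of_supNorm_succ_le z hn)⟩ :
              PIdx 4 (2 * n + 1)) (1 : ℝ)) +
            exactEnergy dMat (Pi.single (⟨(z + diag 4 n, 0, 1), add_diag_mem_plaquettesIn z hn⟩ : PIdx 4 (2 * n + 1)) (1 : ℝ))) /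
            (2 * βV)) with hP
    set u : ℝ := Real.exp (((dMatᵀ *ᵥ (Pi.single (⟨(diag 4 n, 0, 1), diag_mem_plaquettesIn (one_le_of_supNorm_succ_le z hn)⟩ :
                  PIdx 4 (2 * n + 1)) (1 : ℝ) : PIdx 4 (2 * n + 1) → ℝ)) ⬝ᵥ
                ((gram (dMat (d := 4) (n := 2 * n + 1)))⁻¹ *ᵥ (dMatᵀ *ᵥ
                  (Pi.single (⟨(z + diag 4 n, 0, 1), add_diag_mem_plaquettesIn z hn⟩ : PIdx 4 (2 * n + 1)) (1 : ℝ) :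
                    PIdx 4 (2 * n + 1) → ℝ)))) / βV) with hu
    set v : ℝ := Real.exp (-((dMatᵀ *ᵥ (Pi.single (⟨(diag 4 n, 0, 1), diag_mem_plaquettesIn (one_le_of_supNorm_succ_le z hn)⟩ :
                  PIdx 4 (2 * n + 1)) (1 : ℝ) : PIdx 4 (2 * n + 1) → ℝ)) ⬝ᵥ
                ((gram (dMat (d := 4) (n := 2 * n + 1)))⁻¹ *ᵥ (dMatᵀ *ᵥ
                  (Pi.single (⟨(z + diag 4 n, 0, 1), add_diag_mem_plaquettesIn z hn⟩ : PIdx 4 (2 * n + 1)) (1 : ℝ) :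
                    PIdx 4 (2 * n + 1) → ℝ)))) / βV) with hv
    set Am : ℝ := (∑' ξ : (PIdx 4 (2 * n + 1) → ℤ) ⧸ (VillainFibre.dFree (d := 4) (n := 2 * n + 1)).range,
                  coulombWeight βV ξ * Real.cos (perpPart dMat (fluxRep ξ) ⬝ᵥ fun r =>
                    ((Pi.single (⟨(diag 4 n, 0, 1), diag_mem_plaquettesIn (one_le_of_supNorm_succ_le z hn)⟩ : PIdx 4 (2 * n + 1))
                        (1 : ℤ) -
                      Pi.single (⟨(z + diag 4 n, 0, 1), add_diag_mem_plaquettesIn z hn⟩ : PIdx 4 (2 * n + 1)) 1 :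
                        PIdx 4 (2 * n + 1) → ℤ) r : ℝ))) /
                ∑' ξ : (PIdx 4 (2 * n + 1) → ℤ) ⧸ (VillainFibre.dFree (d := 4) (n := 2 * n + 1)).range, coulombWeight βV ξ with hAm
    set Ap : ℝ := (∑' ξ : (PIdx 4 (2 * n + 1) → ℤ) ⧸ (VillainFibre.dFree (d := 4) (n := 2 * n + 1)).range,
                  coulombWeight βV ξ * Real.cos (perpPart dMat (fluxRep ξ) ⬝ᵥ fun r =>
                    ((Pi.single (⟨(diag 4 n, 0, 1), diag_mem_plaquettesIn (one_le_of_supNorm_succ_le z hn)⟩ : PIdx 4 (2 * n + 1))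
                        (1 : ℤ) +
                      Pi.single (⟨(z + diag 4 n, 0, 1), add_diag_mem_plaquettesIn z hn⟩ : PIdx 4 (2 * n + 1)) 1 :
                        PIdx 4 (2 * n + 1) → ℤ) r : ℝ))) /
                ∑' ξ : (PIdx 4 (2 * n + 1) → ℤ) ⧸ (VillainFibre.dFree (d := 4) (n := 2 * n + 1)).range, coulombWeight βV ξ with hAp
    -- `V = a · SW + R(a)`
    have hsplit : 1 / 2 * P * (u * Am - v * Ap) - freeK z / (β's / a) =
        a * (1 / 2 * P * (u - v) - freeK z / β's) + (1 / 2 * P * (u * (Am - a) - v * (Ap - a))) := by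
      field_simp
      ring
    rw [hsplit]
    have h1 : |a * (1 / 2 * P * (u - v) - freeK z / β's)| ≤ a * (Cs / βV * weight z) := by
      rw [abs_mul, abs_of_pos ha0]
      exact mul_le_mul_of_nonneg_left hS' ha0.le
    have h2 : a * (Cs / βV * weight z) ≤ Cs / βV * weight z := by
      have h0 : 0 ≤ Cs / βV * weight z := by have := weight_pos z; positivity
      nlinarith
    calc |a * (1 / 2 * P * (u - v) - freeK z / β's) + 1 / 2 * P * (u * (Am - a) - v * (Ap - a))|
        ≤ |a * (1 / 2 * P * (u - v) - freeK z / β's)| + |1 / 2 * P * (u * (Am - a) - v * (Ap - a))| := abs_add_le _ _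
      _ ≤ Cs / βV * weight z + Cg / βV * weight z := add_le_add (h1.trans h2) hG'
      _ = (Cg + Cs) / βV * weight z := by ring

end Summit.QuantumFields.YangMills.Theorems.U1DipoleHelicity

end
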